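import Literature.MathematicalPhysics.QuantumLattice.VariationalEquilibriumExistence
import Literature.MathematicalPhysics.QuantumLattice.LayeredThermalEnergyWindows
import HarnessLib

/-!
# Stability of variational equilibrium states: the pressure is Lipschitz in `β` and in the couplings, and weak-⋆ limits of
# equilibrium states along convergent parameters are equilibrium states (closed phase diagram)

Topic `Literature/MathematicalPhysics/QuantumLattice` (family `hubbard`; crew hubbard-fast S2/S3 «phase map over T × couplings»).
Sequel of `VariationalEquilibriumExistence.lean` (u.s.c. of the mean entropy; equilibrium states exist; limits of equilibria at FIXED
parameters are equilibria). For the phase map one needs the parameter-dependent statement — the graph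
`{(β, θ, ω) : ω equilibrium at (β, Ψ(θ))}` is closed — which follows from the Lipschitz continuity of the variational pressure:

* §1 `abs_varPressure_sub_varPressure_beta_le`: **`|P(β,Ψ) − P(β',Ψ)| ≤ |β − β'|·‖E_Ψ‖`** (every model), hence `Tendsto` forms in `β` and,
  with `abs_varPressure_linearFamily_sub_le`, joint continuity in `(β, θ)` along sequences (`tendsto_varPressure_of_tendsto`).
* §2 **closed graph**: if `ω_k` is an equilibrium state at `(β_k, Ψ(θ_k))`, `β_k → β`, `θ_k → θ` and `ω_k → ω` on local observables, then `ω`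
  is an equilibrium state at `(β, Ψ(θ))` (`isVarEquilibrium_of_tendsto_params`); temperature-only and coupling-only forms.
* §3 the entropy density of an equilibrium state from pressures: `s̄(ω) = P(β) + βe_Ψ(ω)` with the Griffiths energy window
  (`IsVarEquilibrium.entropyDensitySup_mem_Icc`) — certified ENTROPY windows for the TL equilibrium states of any model from three pressures.

Everything is PROVED; no definition, no named fact, no number. HONEST SCOPE: sequential statements (the state space is metrisable in the
weak-⋆ topology used here, so nothing is lost); no uniqueness.

## Tree / Mathlib search

REUSED: `varPressure_le`, `sub_mul_le_varPressure`, `abs_meanEnergy_le_norm`, `abs_varPressure_linearFamily_sub_le`, `IsVarEquilibrium`,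
`meanEnergy_linearFamily_eq_add_sum_sub_mul` (`TIVariationalPressure`, `…CouplingFamilies`); `isVarEquilibrium_of_tendsto_expect_of_tendsto`
(`VariationalEquilibriumExistence`); `tendsto_meanEnergy_of_tendsto_expect` (`InfVolFermionStateWeakLimits`); `IsVarEquilibrium.meanEnergy_mem_Icc_beta`
(`LayeredThermalEnergyWindows`); Mathlib `squeeze_zero_norm`, `tendsto_finsetSum`.

## References

* R. B. Israel, *Convexity in the Theory of Lattice Gases* (1979), Thm. I.3.4 (Lipschitz continuity of the pressure), §II.3 / Thm. I.2.4
  (equilibrium states as tangent functionals; closedness). [cite: Israel1979, Thm. I.2.4]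
* O. Bratteli, D. W. Robinson, *OAQSM 2* (1997), Thm. 6.2.40 and Prop. 6.2.38. [cite: BratteliRobinsonII1997, Thm. 6.2.40]
-/

noncomputable section

open scoped ComplexOrder BigOperators Matrix.Norms.L2Operator
open Finset Literature.InformationTheory.Entropy

namespace Literature.MathematicalPhysics.QuantumLattice

open Matrix HubbardWave0 Literature.Probability.LatticeModels ThermodynamicLimit
open _root_.Filter
open scoped _root_.Topology

variable {d : ℕ}

/-! ### §1. Lipschitz continuity of the variational pressure in `β` and in the couplings -/

namespace FermionInteraction

variable (Ψ : FermionInteraction d) (R : ℝ)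

/-- **`|P(β,Ψ) − P(β',Ψ)| ≤ |β − β'|·‖E_Ψ‖`**: the variational pressure is Lipschitz in the inverse temperature with constant the norm of the
mean-energy observable (every TI state's functional `s̄ − βe` is). [cite: Israel1979, Thm. I.3.4] -/
theorem abs_varPressure_sub_varPressure_beta_le (β β' : ℝ) :
    |Ψ.varPressure β R - Ψ.varPressure β' R| ≤ |β - β'| * ‖Ψ.meanEnergyObs R‖ := by
  have key : ∀ b b' : ℝ, Ψ.varPressure b R ≤ Ψ.varPressure b' R + |b - b'| * ‖Ψ.meanEnergyObs R‖ := by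
    intro b b'
    refine Ψ.varPressure_le b R fun ω hω => ?_
    have h1 := Ψ.sub_mul_le_varPressure b' R hω
    have h2 : b' * ω.meanEnergy Ψ R - b * ω.meanEnergy Ψ R ≤ |b - b'| * ‖Ψ.meanEnergyObs R‖ := by
      rw [← sub_mul, show (b' - b) * ω.meanEnergy Ψ R = -((b - b') * ω.meanEnergy Ψ R) by ring]
      refine (neg_le_abs _).trans ?_
      rw [abs_mul]
      exact mul_le_mul_of_nonneg_left (ω.abs_meanEnergy_le_norm Ψ R) (abs_nonneg _)
    linarith
  rw [abs_le]
  constructor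
  · have h := key β' β
    rw [abs_sub_comm] at h
    linarith
  · linarith [key β β']

/-- `β ↦ P(β,Ψ)` is continuous (sequential form). [cite: Israel1979, Thm. I.3.4] -/
theorem tendsto_varPressure_beta {βs : ℕ → ℝ} {β : ℝ} (hβ : Tendsto βs atTop (𝓝 β)) :
    Tendsto (fun k => Ψ.varPressure (βs k) R) atTop (𝓝 (Ψ.varPressure β R)) := by
  rw [tendsto_iff_norm_sub_tendsto_zero]
  have h0 : Tendsto (fun k => |βs k - β| * ‖Ψ.meanEnergyObs R‖) atTop (𝓝 0) := by
    have h := (tendsto_iff_norm_sub_tendsto_zero.1 hβ).mul_const ‖Ψ.meanEnergyObs R‖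
    rw [zero_mul] at h
    exact h
  exact squeeze_zero (fun k => norm_nonneg _) (fun k => by
    rw [Real.norm_eq_abs]; exact Ψ.abs_varPressure_sub_varPressure_beta_le R (βs k) β) h0

end FermionInteraction

section Family

variable {ι : Type*} [Fintype ι] (Ψ₀ : FermionInteraction d) (Ψv : ι → FermionInteraction d) (R : ℝ)

/-- **Joint continuity of the pressure of a linear family in `(β, θ)`** (sequential form): `β_k → β`, `θ_k → θ` imply
`P(β_k, Ψ(θ_k)) → P(β, Ψ(θ))`. [cite: Israel1979, Thm. I.3.4] -/
theorem tendsto_varPressure_of_tendsto {βs : ℕ → ℝ} {β : ℝ} (hβ : Tendsto βs atTop (𝓝 β)) {θs : ℕ → ι → ℝ} {θ : ι → ℝ}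
    (hθ : ∀ a, Tendsto (fun k => θs k a) atTop (𝓝 (θ a))) :
    Tendsto (fun k => (FermionInteraction.linearFamily Ψ₀ Ψv (θs k)).varPressure (βs k) R) atTop
      (𝓝 ((FermionInteraction.linearFamily Ψ₀ Ψv θ).varPressure β R)) := by
  -- split: `P(β_k, θ_k) − P(β_k, θ)` is small uniformly (Lipschitz in θ with constant `|β_k| Σ …`), and `P(β_k, θ) → P(β, θ)`
  have h1 := (FermionInteraction.linearFamily Ψ₀ Ψv θ).tendsto_varPressure_beta R hβ
  have hdiff : Tendsto (fun k => (FermionInteraction.linearFamily Ψ₀ Ψv (θs k)).varPressure (βs k) R -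
      (FermionInteraction.linearFamily Ψ₀ Ψv θ).varPressure (βs k) R) atTop (𝓝 0) := by
    have hsum : Tendsto (fun k => |βs k| * ∑ a, |θs k a - θ a| * ‖(Ψv a).meanEnergyObs R‖) atTop (𝓝 0) := by
      have hs : Tendsto (fun k => ∑ a, |θs k a - θ a| * ‖(Ψv a).meanEnergyObs R‖) atTop (𝓝 0) := by
        have h := tendsto_finsetSum (Finset.univ : Finset ι) fun a _ =>
          ((tendsto_iff_norm_sub_tendsto_zero.1 (hθ a)).mul_const ‖(Ψv a).meanEnergyObs R‖)
        simp only [zero_mul, Finset.sum_const_zero] at h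
        refine h.congr fun k => Finset.sum_congr rfl fun a _ => ?_
        rw [Real.norm_eq_abs]
      have h := (continuous_abs.tendsto β |>.comp hβ).mul hs
      rw [mul_zero] at h
      exact h
    exact squeeze_zero_norm (fun k => by
      rw [Real.norm_eq_abs]; exact abs_varPressure_linearFamily_sub_le Ψ₀ Ψv (βs k) R (θs k) θ) hsum
  have h := hdiff.add h1
  rw [zero_add] at h
  exact h.congr fun k => by ring

end Family

/-! ### §2. The graph of the equilibrium correspondence is closed -/

namespace InfVolFermionState

variable {ωs : ℕ → InfVolFermionState d} {ωl : InfVolFermionState d}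

/-- **CLOSED GRAPH, general form**: equilibrium states `ω_k` at `(β_k, Ψ_k)` converging locally to `ω`, with `β_k → β`,
`P(β_k,Ψ_k) → P(β,Ψ)` and the energies `e_{Ψ_k}(ω_k) − e_Ψ(ω_k) → 0`, give an equilibrium state `ω` at `(β, Ψ)` (`d ≥ 1`).
[cite: Israel1979, Thm. I.2.4] [cite: BratteliRobinsonII1997, Thm. 6.2.40] -/
theorem isVarEquilibrium_of_tendsto_general (hd : 0 < d) {βs : ℕ → ℝ} {β : ℝ} {Ψs : ℕ → FermionInteraction d}
    {Ψ : FermionInteraction d} {Rs : ℕ → ℝ} {R : ℝ}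
    (hlim : ∀ (Λ : Finset (Site d)) (A : FermionOp Λ), Tendsto (fun j => (ωs j).expect Λ A) atTop (𝓝 (ωl.expect Λ A)))
    (heq : ∀ j, (ωs j).IsVarEquilibrium (βs j) (Ψs j) (Rs j)) (hβ : Tendsto βs atTop (𝓝 β))
    (hP : Tendsto (fun j => (Ψs j).varPressure (βs j) (Rs j)) atTop (𝓝 (Ψ.varPressure β R)))
    (hE : Tendsto (fun j => (ωs j).meanEnergy (Ψs j) (Rs j) - (ωs j).meanEnergy Ψ R) atTop (𝓝 0)) :
    ωl.IsVarEquilibrium β Ψ R := by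
  refine isVarEquilibrium_of_tendsto_expect_of_tendsto hd hlim (fun j => (heq j).1) ?_
  -- `s̄(ω_j) − β e_Ψ(ω_j) = P(β_j,Ψ_j) + β_j e_{Ψ_j}(ω_j) − β e_Ψ(ω_j)`
  have he := tendsto_meanEnergy_of_tendsto_expect hlim Ψ R
  have hid : ∀ j, (ωs j).entropyDensitySup - β * (ωs j).meanEnergy Ψ R =
      (Ψs j).varPressure (βs j) (Rs j) + (βs j * ((ωs j).meanEnergy (Ψs j) (Rs j) - (ωs j).meanEnergy Ψ R) +
        (βs j - β) * (ωs j).meanEnergy Ψ R) := fun j => by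
    have h := (heq j).2; linarith [h]
  simp only [hid]
  have h2 : Tendsto (fun j => βs j * ((ωs j).meanEnergy (Ψs j) (Rs j) - (ωs j).meanEnergy Ψ R) +
      (βs j - β) * (ωs j).meanEnergy Ψ R) atTop (𝓝 0) := by
    have ha := hβ.mul hE
    have hb : Tendsto (fun j => (βs j - β) * (ωs j).meanEnergy Ψ R) atTop (𝓝 0) := by
      have h := (hβ.sub (tendsto_const_nhds (x := β))).mul he
      rw [sub_self, zero_mul] at h
      exact h
    have h := ha.add hb
    rw [mul_zero, zero_add] at h
    exact h
  have h := hP.add h2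
  rw [add_zero] at h
  exact h

/-- **Closed graph in the temperature**: equilibrium states at `β_k → β` (same interaction) converge to equilibrium states at `β`.
[cite: Israel1979, Thm. I.2.4] -/
theorem isVarEquilibrium_of_tendsto_beta (hd : 0 < d) {βs : ℕ → ℝ} {β : ℝ} {Ψ : FermionInteraction d} {R : ℝ}
    (hlim : ∀ (Λ : Finset (Site d)) (A : FermionOp Λ), Tendsto (fun j => (ωs j).expect Λ A) atTop (𝓝 (ωl.expect Λ A)))
    (heq : ∀ j, (ωs j).IsVarEquilibrium (βs j) Ψ R) (hβ : Tendsto βs atTop (𝓝 β)) : ωl.IsVarEquilibrium β Ψ R :=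
  isVarEquilibrium_of_tendsto_general hd hlim heq hβ (Ψ.tendsto_varPressure_beta R hβ)
    (by simp only [sub_self]; exact tendsto_const_nhds)

/-- **Closed graph in `(β, θ)` for a linear family of couplings** `Ψ(θ) = Ψ₀ + Σ θ_aΨ_a`: equilibrium states at `(β_k, θ_k) → (β, θ)`
converge (locally, along subsequences — which always exist) to equilibrium states at `(β, θ)`. This is the closedness of the phase diagram
used when a phase map is filled in cell by cell. [cite: Israel1979, Thm. I.2.4] [cite: BratteliRobinsonII1997, Thm. 6.2.40] -/
theorem isVarEquilibrium_of_tendsto_params (hd : 0 < d) {ι : Type*} [Fintype ι] {Ψ₀ : FermionInteraction d}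
    {Ψv : ι → FermionInteraction d} {R : ℝ} {βs : ℕ → ℝ} {β : ℝ} {θs : ℕ → ι → ℝ} {θ : ι → ℝ}
    (hlim : ∀ (Λ : Finset (Site d)) (A : FermionOp Λ), Tendsto (fun j => (ωs j).expect Λ A) atTop (𝓝 (ωl.expect Λ A)))
    (heq : ∀ j, (ωs j).IsVarEquilibrium (βs j) (FermionInteraction.linearFamily Ψ₀ Ψv (θs j)) R)
    (hβ : Tendsto βs atTop (𝓝 β)) (hθ : ∀ a, Tendsto (fun k => θs k a) atTop (𝓝 (θ a))) :
    ωl.IsVarEquilibrium β (FermionInteraction.linearFamily Ψ₀ Ψv θ) R := by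
  refine isVarEquilibrium_of_tendsto_general hd hlim heq hβ (tendsto_varPressure_of_tendsto Ψ₀ Ψv R hβ hθ) ?_
  -- `e_{θ_k}(ω_k) − e_θ(ω_k) = Σ_a (θ_k a − θ a) e_a(ω_k)`, each `e_a(ω_k)` bounded by `‖E_a‖`
  have hid : ∀ j, (ωs j).meanEnergy (FermionInteraction.linearFamily Ψ₀ Ψv (θs j)) R -
      (ωs j).meanEnergy (FermionInteraction.linearFamily Ψ₀ Ψv θ) R = ∑ a, (θs j a - θ a) * (ωs j).meanEnergy (Ψv a) R := fun j => by
    rw [(ωs j).meanEnergy_linearFamily_eq_add_sum_sub_mul Ψ₀ Ψv (θs j) θ R, add_sub_cancel_left]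
  simp only [hid]
  have hterm : ∀ a : ι, Tendsto (fun j => (θs j a - θ a) * (ωs j).meanEnergy (Ψv a) R) atTop (𝓝 0) := by
    intro a
    have hg : Tendsto (fun j => ‖θs j a - θ a‖ * ‖(Ψv a).meanEnergyObs R‖) atTop (𝓝 0) := by
      have h := (tendsto_iff_norm_sub_tendsto_zero.1 (hθ a)).mul_const ‖(Ψv a).meanEnergyObs R‖
      rwa [zero_mul] at h
    refine squeeze_zero_norm (fun j => ?_) hg
    rw [norm_mul, Real.norm_eq_abs, Real.norm_eq_abs]
    exact mul_le_mul_of_nonneg_left ((ωs j).abs_meanEnergy_le_norm (Ψv a) R) (abs_nonneg _)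
  have h := tendsto_finsetSum (Finset.univ : Finset ι) fun a _ => hterm a
  simp only [Finset.sum_const_zero] at h
  exact h

/-! ### §3. Entropy densities of equilibrium states from pressures -/

/-- **The entropy density of an equilibrium state from three pressures** (`δ > 0`): `s̄(ω) = P(β) + βe_Ψ(ω)` and the Griffiths energy window
give `s̄(ω) ∈ [P(β) + β(P(β) − P(β+δ))/δ, P(β) + β(P(β−δ) − P(β))/δ]` for `β ≥ 0` — certified entropy windows for thermodynamic-limit
equilibrium states of any model from certified pressures. [cite: Israel1979, Thm. I.2.4] -/
theorem IsVarEquilibrium.entropyDensitySup_mem_Icc {β : ℝ} (hβ : 0 ≤ β) {Ψ : FermionInteraction d} {R : ℝ} {ω : InfVolFermionState d}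
    (h : ω.IsVarEquilibrium β Ψ R) {δ : ℝ} (hδ : 0 < δ) :
    ω.entropyDensitySup ∈ Set.Icc
      (Ψ.varPressure β R + β * ((Ψ.varPressure β R - Ψ.varPressure (β + δ) R) / δ))
      (Ψ.varPressure β R + β * ((Ψ.varPressure (β - δ) R - Ψ.varPressure β R) / δ)) := by
  have hw := h.meanEnergy_mem_Icc_beta hδ
  have hs : ω.entropyDensitySup = Ψ.varPressure β R + β * ω.meanEnergy Ψ R := by linarith [h.2]
  rw [hs]
  exact ⟨by nlinarith [hw.1], by nlinarith [hw.2]⟩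

end InfVolFermionState

end Literature.MathematicalPhysics.QuantumLattice

end
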